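import Summits.BirchSwinnertonDyer.BirchSwinnertonDyer.Theorems.QuadraticBranchSignedControlPlusEtaNonsurjFineRoadCM
import Literature.NumberTheory.EllipticCurves.ZywinaCMImageProofs
import Summits.BirchSwinnertonDyer.Rank1Residual.O6.X4CongruenceAnchor
import HarnessLib

/-!
# Route `QuadraticBranchSignedControl` (rung K8, cell `bsd-potss`), residual crux `PlusEtaMainConjectureNonsurj`
# (stmt-BirchSwinnertonDyer-19606): the (A)-ANCHORED VARIANT of the CM-anchor transfer road — Kobayashi's even main conjecture at `η`
# for `(V, p)` on every row congruent mod `p` to the GOOD twist of a CM anchor of ANY rank at which (A) and the analytic `μ = 0` are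
# displayed, from ONE displayed transfer frame (the body of the OPEN binder `CorpuzLei2025_etaPlusMainConjecture_transfer_anMu_OPEN`,
# Corpuz–Lei arXiv:2508.09733 Thms 1–3 at `i = (p−1)/2`, PREPRINT) + Burungale–Tian + Kobayashi Thm. 2.2 / 6.2 / 6.3 / 7.3 at `η`
# (a `--supports` file; seat `bsd-potss-k8eta-c2` g8; CORRECTION of the seat's unit-anchor census)

WHY (CORRECTION OF RECORD). The unit-anchor road `EtaCMAnchorTransfer.quadraticBranchPlusEtaMainConjectureAt_of_cmUnitAnchor_of_transferFrame`
(p552531) needs a good `a_p = 0` model `V′` of the ANCHOR's `p*`-twist. Of the nine CM unit anchors of the 30 non-CM rows of the crux below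
`5·10⁵` (census `pub/bsd-potss/k8eta-c2/g8/K8-CM-UNIT-ANCHORS-k8eta-c2-g8.tsv`), the four unit SIBLINGS `[0,0,0,0,−675]`, `[0,0,1,0,−169]`,
`[0,0,0,0,800]`, `[0,0,1,0,−405169]` (k8eta-c2 g7) have `v₅(c₆) = 2`, so their `5`-twists have ADDITIVE reduction at `5` (`v₅(Δ_min) = 10`): for
the 16 rows of their classes the unit-anchor records are vacuous. Those classes (of `2700p1`, `675a1`, `14400l1`, `11025b1`) DO contain CM
curves whose `5`-twist is good with `a_5 = 0` — the RANK-1 anchors of record themselves (`v₅(c₆) = 3`) — at whose twist `V″` (C1⁺_η) is NOT a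
unit-row theorem but k8eta-c2 g7's `EtaFineRoad.etaMC_cmRows_of_bt26_of_conjA_of_analyticMu`: (C1⁺_η)(V″,p) ⟸ Burungale–Tian Thm 2.6 (`h26`)
+ Kobayashi Thm 2.2η / 6.2 / 6.3 / 7.3η (`h22`, `h6273`) + Coates–Sujatha (A) for the anchor (`hA″`, displayed — certified in-table by
Deo–Ray–Sujatha Thm 3.7, kit j277504: 2700p1, 675a1, 14400l1, 11025b1 PASS) + the analytic `μ(L_p⁺(V″,η,X)) = 0` (`hμan″`, displayed, PARI).
The transfer binder is read with the anchor's `μ = 0` on the ANALYTIC side (`CorpuzLei2025_etaPlusMainConjecture_transfer_anMu_OPEN`, the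
APPEND of `…CorpuzLeiTransferOPEN.lean`, proposal p558472; HERE its BODY is the displayed hypothesis `hCL`).

* §1 **`quadraticBranchPlusEtaMainConjectureAt_of_cmConjAAnchor_of_transferFrame`** — the road: CM anchor `A` (any rank), `V″` a globally
  minimal model of `A^{(p*)}` good at `p` with `a_p(V″) = 0`, (A)(A,p) and the analytic `μ` at `V″` displayed; `V` good `a_p = 0` with
  `ModPCongruent V″ V p` ⟹ (C1⁺_η)(V,p) — ANY rank / `L_p⁺`-shape of the row, nothing else displayed at the row.
* §2 `…_models_…` — the ∀-models form consumed by the per-row records (`…CMConjAAnchorTransferRecords*.lean`).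

HONEST FRAMING (cell `bsd-potss`; HUMAN RULING D-0036/D-0074): TOOL THEOREMS ONLY — no definition, no new fact, no `sorry`, axioms standard;
CONDITIONAL on the displayed frame `hCL` (an unrefereed preprint, flag `CL25-eta-plus-dictionary`), on `h26 h22 h6273` (named published facts)
and on the displayed anchor inputs ((A), analytic `μ`). Weaker than the unit-anchor road in evidence grade ((A) at a rank-1 CM curve is
Conjecture A, certified per anchor by DRS-3.7, not a theorem). 19606 stays OPEN; no stub proved by name; nothing booked; BSD(W,p) claimed for no pair.
`--supports stmt-BirchSwinnertonDyer-19606`.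

References: [CorpuzLei2025] Thms 1–3 (claim); [BurungaleTian2026] Thm. 2.6; [Kobayashi2003] Thm. 2.2, §4, Thm. 6.2/6.3, Thm. 7.3 i), Cor. 7.2;
[CoatesSujatha2005] §3 (A); [DeoRaySujatha2023] Thm. 3.7; [GreenbergVatsal2000] Thm. (1.4); [Zywina2015] Prop. 1.14 (CM images are not onto).
-/

set_option autoImplicit false
set_option linter.dupNamespace false

noncomputable section

open scoped Classical

open CongruenceSubgroup Field Function NumberField IsDedekindDomain WeierstrassCurve
open Literature.NumberTheory.EllipticCurves
open Literature.NumberTheory.EllipticCurves.ModularForms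
open Literature.NumberTheory.EllipticCurves.Rank1Residual
open Literature.NumberTheory.EllipticCurves.Rank1Residual.Typed
open Literature.NumberTheory.GaloisRepresentations
open Literature.NumberTheory.GaloisCohomology
open Literature.NumberTheory.EllipticCurves.IwasawaAlgebra
open Literature.NumberTheory.EllipticCurves.IwasawaDual ZpExtension
open Literature.NumberTheory.EllipticCurves.GreenbergVatsal2000
open Summit.BirchSwinnertonDyer.Rank1Residual.X11b.Levels
open Summit.BirchSwinnertonDyer.Rank1Residual.X11b
open Summit.BirchSwinnertonDyer.Rank1Residual.Additive
open Summit.BirchSwinnertonDyer.Rank1Residual.Additive.SignedTwist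
open scoped ContRepresentation
open Summit.BirchSwinnertonDyer.Rank1Residual.AdditivePotMult
open Summit.BirchSwinnertonDyer.Rank1Residual.O6 (ModPCongruent)

namespace Summit.BirchSwinnertonDyer.BirchSwinnertonDyer.Theorems

namespace EtaCMConjAAnchorTransfer

section Road

variable (p : ℕ) [hp : Fact p.Prime]

/-- **THE (A)-ANCHORED TRANSFER ROAD.** DATA: `p ≥ 5`; a CM curve `A/ℚ` (globally minimal, ANY rank); a globally minimal model `V″` of
`A^{(p*)}` (`C″ • A.quadraticTwist (±p) = V″`) good at `p` with `a_p(V″) = 0`; (A)(A,p) in the cell's `∃ γ D` currency (`hA`, displayed); the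
analytic `μ(L_p⁺(V″,η,X)) = 0` (`hμan`, displayed); a globally minimal `V`, good at `p` with `a_p(V) = 0`, `ModPCongruent V″ V p`. FRAME `hCL`
(displayed; = the body of `CorpuzLei2025_etaPlusMainConjecture_transfer_anMu_OPEN`, PRE). NAMED FACTS: `h26` (Burungale–Tian Thm 2.6), `h22`,
`h6273` (Kobayashi). CONCLUSION: `QuadraticBranchPlusEtaMainConjectureAt V p`, for a row of ANY rank and ANY `L_p⁺`-shape. PROOF: `V″` is CM and
its tower is not onto (Zywina: CM images are never surjective at an odd prime); (C1⁺_η)(V″,p) by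
`EtaFineRoad.etaMC_cmRows_of_bt26_of_conjA_of_analyticMu`; feed the frame. CONDITIONAL; nothing booked; no hypothesis on the row beyond its model.
[claim: CorpuzLei2025, status: under-review] [cite: BurungaleTian2026, Thm. 2.6] [cite: Kobayashi2003, Thm. 2.2 (p. 5), §4 (p. 8), Thm. 7.3 i) and Cor. 7.2]
[cite: CoatesSujatha2005, §3 statement (A)] [cite: GreenbergVatsal2000, Thm. (1.4)] [cite: Zywina2015, Prop. 1.14 and Prop. 1.16] -/
theorem quadraticBranchPlusEtaMainConjectureAt_of_cmConjAAnchor_of_transferFrame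
    (hCL : ∀ (V V' : WeierstrassCurve ℚ) [V.IsElliptic] [V.IsGloballyMinimal] [V'.IsElliptic]
        [V'.IsGloballyMinimal] (p : ℕ) [Fact p.Prime],
        p ≠ 2 →
        V.HasGoodReductionAtPrime p → V.frobeniusTrace p = 0 →
        V'.HasGoodReductionAtPrime p → V'.frobeniusTrace p = 0 →
        (∃ e : geomTorsion V' (p : ℤ) ≃+ geomTorsion V (p : ℤ),
          ∀ (σ : absoluteGaloisGroup ℚ) (P : geomTorsion V' (p : ℤ)), e (σ • P) = σ • e P) →
        QuadraticBranchPlusEtaMainConjectureAt V' p →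
        (∀ {N : ℕ} [NeZero N] {f' : CuspForm (Gamma0 N) 2}, IsNewformOf V' f' →
          ∀ (ϖ' : ℚ), (if Even (p / 2) then (ϖ' : ℝ) * V'.realPeriodRat = plusPeriod f'
              else (ϖ' : ℝ) * V'.imaginaryPeriodRat = minusPeriod f') →
          ∀ (Lη' : IwasawaAlgebra p), IsQuadraticBranchPlusLFunction f' p ϖ' Lη' → HasUnitContent Lη') →
        QuadraticBranchPlusEtaMainConjectureAt V p)
    (h26 : BurungaleTian2026.thm26_etaKatoSequences_charIdeal_upToP_of_cm)
    (h22 : Kobayashi2003.thm22_etaSignedSelmerDual_finite_torsion)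
    (h6273 : Kobayashi2003.thm62_63_73_etaColemanPoitouTate) (hp5 : 5 ≤ p)
    (A : WeierstrassCurve ℚ) [A.IsElliptic] [A.IsGloballyMinimal] (hCM : A.HasCM)
    (hA : ∀ (κ : ZpExtension ℚ p), κ.IsCyclotomic →
      ∃ (γ : absoluteGaloisGroup ℚ) (D : A.FineSelmerDualData κ γ),
        Module.Finite ℤ_[p] (RestrictScalars ℤ_[p] (IwasawaAlgebra p) D.X))
    (V'' : WeierstrassCurve ℚ) [V''.IsElliptic] [V''.IsGloballyMinimal] (C'' : VariableChange ℚ)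
    (hC''V'' : C'' • A.quadraticTwist ((-1) ^ (p / 2) * p) = V'') (hgood'' : V''.HasGoodReductionAtPrime p)
    (hap'' : V''.frobeniusTrace p = 0)
    (hμan : ∀ {N : ℕ} [NeZero N] {f : CuspForm (Gamma0 N) 2}, IsNewformOf V'' f →
      ∀ (ϖ : ℚ), (if Even (p / 2) then (ϖ : ℝ) * V''.realPeriodRat = plusPeriod f
          else (ϖ : ℝ) * V''.imaginaryPeriodRat = minusPeriod f) →
      ∀ (Lη : IwasawaAlgebra p), IsQuadraticBranchPlusLFunction f p ϖ Lη → HasUnitContent Lη)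
    (V : WeierstrassCurve ℚ) [V.IsElliptic] [V.IsGloballyMinimal] (hgood : V.HasGoodReductionAtPrime p)
    (hap : V.frobeniusTrace p = 0) (hcong : ModPCongruent V'' V p) :
    QuadraticBranchPlusEtaMainConjectureAt V p := by
  have hp2 : p ≠ 2 := by omega
  -- `V″` is CM: `j(V″) = j(A^{(p*)}) = j(A)`
  have hd : ((-1 : ℚ) ^ (p / 2) * p) ≠ 0 :=
    mul_ne_zero (pow_ne_zero _ (neg_ne_zero.mpr one_ne_zero)) (Nat.cast_ne_zero.mpr hp.out.ne_zero)
  haveI := A.isElliptic_quadraticTwist hd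
  have hj : V''.j = A.j := by subst hC''V''; rw [variableChange_j, j_quadraticTwist A hd]
  have hCM'' : V''.HasCM := (hasCM_iff_of_j_eq hj).mpr hCM
  -- the tower of a CM curve is not onto (already at level `m = 1`)
  have hns'' : ¬ (∀ m : ℕ, V''.HasSurjectiveModNGaloisRep (p ^ m : ℕ)) := by
    intro h
    exact V''.not_hasSurjectiveModNGaloisRep_of_hasCM hCM'' hp.out hp2 (by simpa using h 1)
  -- (C1⁺_η) at the anchor's twist: Burungale–Tian + (A) + analytic `μ`
  have hMC'' : QuadraticBranchPlusEtaMainConjectureAt V'' p :=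
    EtaFineRoad.etaMC_cmRows_of_bt26_of_conjA_of_analyticMu h26 h22 h6273 V'' p hp5 hgood'' hap'' hns'' hCM'' A C''
      hC''V'' hA hμan
  exact hCL V V'' p hp2 hgood hap hgood'' hap'' hcong hMC'' hμan

/-- **The (A)-anchored road for arbitrary models of the two twists** (the shape of the records): `A`, `W` curves over `ℚ` (the CM anchor and
the row's additive partner), `V″` ANY globally minimal model of `A^{(p*)}` and `V` ANY globally minimal model of `W^{(p*)}`, both good at `p` with
`a_p = 0`, the analytic `μ` at `V″` displayed, and the congruence supplied for these models by a function `hcongVV` of the two model equations.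
CONDITIONAL on the frame `hCL` (PRE) + `h26 h22 h6273` + the displayed (A); nothing booked. [claim: CorpuzLei2025, status: under-review]
[cite: Kobayashi2003, §4 Even main conjecture (p. 8)] [cite: BurungaleTian2026, Thm. 2.6] [cite: CoatesSujatha2005, §3 statement (A)] -/
theorem quadraticBranchPlusEtaMainConjectureAt_models_of_cmConjAAnchor_of_transferFrame
    (hCL : ∀ (V V' : WeierstrassCurve ℚ) [V.IsElliptic] [V.IsGloballyMinimal] [V'.IsElliptic]
        [V'.IsGloballyMinimal] (p : ℕ) [Fact p.Prime],
        p ≠ 2 →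
        V.HasGoodReductionAtPrime p → V.frobeniusTrace p = 0 →
        V'.HasGoodReductionAtPrime p → V'.frobeniusTrace p = 0 →
        (∃ e : geomTorsion V' (p : ℤ) ≃+ geomTorsion V (p : ℤ),
          ∀ (σ : absoluteGaloisGroup ℚ) (P : geomTorsion V' (p : ℤ)), e (σ • P) = σ • e P) →
        QuadraticBranchPlusEtaMainConjectureAt V' p →
        (∀ {N : ℕ} [NeZero N] {f' : CuspForm (Gamma0 N) 2}, IsNewformOf V' f' →
          ∀ (ϖ' : ℚ), (if Even (p / 2) then (ϖ' : ℝ) * V'.realPeriodRat = plusPeriod f'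
              else (ϖ' : ℝ) * V'.imaginaryPeriodRat = minusPeriod f') →
          ∀ (Lη' : IwasawaAlgebra p), IsQuadraticBranchPlusLFunction f' p ϖ' Lη' → HasUnitContent Lη') →
        QuadraticBranchPlusEtaMainConjectureAt V p)
    (h26 : BurungaleTian2026.thm26_etaKatoSequences_charIdeal_upToP_of_cm)
    (h22 : Kobayashi2003.thm22_etaSignedSelmerDual_finite_torsion)
    (h6273 : Kobayashi2003.thm62_63_73_etaColemanPoitouTate) (hp5 : 5 ≤ p)
    (A : WeierstrassCurve ℚ) [A.IsElliptic] [A.IsGloballyMinimal] (hCM : A.HasCM)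
    (hA : ∀ (κ : ZpExtension ℚ p), κ.IsCyclotomic →
      ∃ (γ : absoluteGaloisGroup ℚ) (D : A.FineSelmerDualData κ γ),
        Module.Finite ℤ_[p] (RestrictScalars ℤ_[p] (IwasawaAlgebra p) D.X))
    (W : WeierstrassCurve ℚ)
    (hcongVV : ∀ (V'' V : WeierstrassCurve ℚ),
      (∃ C'' : VariableChange ℚ, C'' • A.quadraticTwist ((-1) ^ (p / 2) * p) = V'') →
      (∃ C : VariableChange ℚ, C • W.quadraticTwist ((-1) ^ (p / 2) * p) = V) → ModPCongruent V'' V p) :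
    ∀ (V'' : WeierstrassCurve ℚ) [V''.IsElliptic] [V''.IsGloballyMinimal]
      (V : WeierstrassCurve ℚ) [V.IsElliptic] [V.IsGloballyMinimal],
      (∃ C'' : VariableChange ℚ, C'' • A.quadraticTwist ((-1) ^ (p / 2) * p) = V'') →
      V''.HasGoodReductionAtPrime p → V''.frobeniusTrace p = 0 →
      (∀ {N : ℕ} [NeZero N] {f : CuspForm (Gamma0 N) 2}, IsNewformOf V'' f →
        ∀ (ϖ : ℚ), (if Even (p / 2) then (ϖ : ℝ) * V''.realPeriodRat = plusPeriod f
            else (ϖ : ℝ) * V''.imaginaryPeriodRat = minusPeriod f) →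
        ∀ (Lη : IwasawaAlgebra p), IsQuadraticBranchPlusLFunction f p ϖ Lη → HasUnitContent Lη) →
      (∃ C : VariableChange ℚ, C • W.quadraticTwist ((-1) ^ (p / 2) * p) = V) →
      V.HasGoodReductionAtPrime p → V.frobeniusTrace p = 0 →
      QuadraticBranchPlusEtaMainConjectureAt V p := by
  intro V'' _ _ V _ _ hC'' hgood'' hap'' hμan hC hgood hap
  have hcong : ModPCongruent V'' V p := hcongVV V'' V hC'' hC
  obtain ⟨C'', hC''V''⟩ := hC''
  exact quadraticBranchPlusEtaMainConjectureAt_of_cmConjAAnchor_of_transferFrame p hCL h26 h22 h6273 hp5 A hCM hA V'' C''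
    hC''V'' hgood'' hap'' hμan V hgood hap hcong

end Road

end EtaCMConjAAnchorTransfer

end Summit.BirchSwinnertonDyer.BirchSwinnertonDyer.Theorems

end
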